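import Mathlib
import Summits.Ventures.HodgeRepro2.T5ProfiniteCharacterExtension
import Summits.Ventures.HodgeRepro2.T5PrincipalUnitFiltration
import Summits.Ventures.HodgeRepro2.T5LocalUnitsProfinite

/-!
# The higher unit groups of a local field are a basis of open subgroups; continuous characters
have finite conductor
(kernel witness for the dictionary between the [A]-ledger's «conductor» of a character of
`𝒪_{E_v}^×` / `E¹_v` and the continuity / open-subgroup language of `T5ProfiniteCharacterExtension`
and `T5ConductorArithmetic`)

`K` is a complete ultrametric nontrivially normed field with `𝒪[K]` a discrete valuation ring and
`ϖ` a uniformiser; `U_n = higherUnits ϖ n ≤ 𝒪[K]ˣ` (`T5PrincipalUnitFiltration`).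

* `mem_higherUnits_iff_norm`, `coe_higherUnits_eq` — `U_n = {u | ‖u − 1‖ ≤ ‖ϖ‖ ^ n}`;
* `isOpen_higherUnits` — **each `U_n` is an open subgroup** (closed balls are open in an
  ultrametric space);
* `exists_higherUnits_subset`, `basis_higherUnits` — **the `U_n` form a neighbourhood basis of
  `1` in `𝒪[K]ˣ`** (so the basis hypothesis of
  `exists_continuous_extension_circle_of_basis` holds with this explicit basis);
* `exists_higherUnits_le_ker` — **a continuous unitary character of `𝒪[K]ˣ` is trivial on some
  `U_n`** («finite conductor»; the hypothesis `∃ n, U n ≤ ker χ` of `T5ConductorArithmetic`);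
* `continuous_iff_exists_higherUnits_le_ker` — continuity ⟺ finite conductor (unitary);
  `continuous_of_higherUnits_le_ker` — the `ℂˣ`-valued direction.

Imports: Mathlib + three accepted files of this prefix; axioms standard.
Uses an L-value-free non-vanishing device: NO (README §8(d)).
-/
namespace Summit.Ventures.HodgeRepro2.T5LocalUnitsFiltration

open scoped NormedField Valued
open Summit.Ventures.HodgeRepro2.T5ProfiniteCharacterExtension
open Summit.Ventures.HodgeRepro2.T5PrincipalUnitFiltration
open Summit.Ventures.HodgeRepro2.T5LocalUnitsProfinite

variable {K : Type*} [NontriviallyNormedField K] [IsUltrametricDist K]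
  [IsDiscreteValuationRing 𝒪[K]] {ϖ : 𝒪[K]}

/-- `u ∈ U_n ↔ ‖u − 1‖ ≤ ‖ϖ‖ ^ n` (`𝓂^n` is the closed ball of radius `‖ϖ‖ ^ n`). -/
theorem mem_higherUnits_iff_norm (hϖ : Irreducible ϖ) (n : ℕ) (u : 𝒪[K]ˣ) :
    u ∈ higherUnits ϖ n ↔ ‖(u : 𝒪[K]) - 1‖ ≤ ‖ϖ‖ ^ n := by
  rw [mem_higherUnits_iff_mem_pow_maximalIdeal ϖ n hϖ, ← SetLike.mem_coe,
    hϖ.maximalIdeal_pow_eq_closedBall_pow, Metric.mem_closedBall, dist_zero_right]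

/-- `U_n` as a set: the preimage under `val` of the closed ball of radius `‖ϖ‖ ^ n` about `1`. -/
theorem coe_higherUnits_eq (hϖ : Irreducible ϖ) (n : ℕ) :
    ((higherUnits ϖ n : Subgroup 𝒪[K]ˣ) : Set 𝒪[K]ˣ) =
      Units.val ⁻¹' Metric.closedBall (1 : 𝒪[K]) (‖ϖ‖ ^ n) := by
  ext u
  rw [SetLike.mem_coe, mem_higherUnits_iff_norm hϖ n u, Set.mem_preimage, Metric.mem_closedBall,
    dist_eq_norm]

/-- **`U_n` is an open subgroup of `𝒪[K]ˣ`** (closed balls are open in an ultrametric space). -/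
theorem isOpen_higherUnits (hϖ : Irreducible ϖ) (n : ℕ) :
    IsOpen ((higherUnits ϖ n : Subgroup 𝒪[K]ˣ) : Set 𝒪[K]ˣ) := by
  rw [coe_higherUnits_eq hϖ n]
  exact (IsUltrametricDist.isOpen_closedBall (1 : 𝒪[K])
    (pow_ne_zero n (Valued.integer.norm_irreducible_pos hϖ).ne')).preimage Units.continuous_val

/-- **The `U_n` form a neighbourhood basis of `1`**: every open set containing `1` contains some
`U_n` (`K` complete, so that `𝒪[K]ˣ` carries the topology induced from `𝒪[K]`). -/
theorem exists_higherUnits_subset [CompleteSpace K] (hϖ : Irreducible ϖ) {W : Set 𝒪[K]ˣ}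
    (hW : IsOpen W) (h1 : (1 : 𝒪[K]ˣ) ∈ W) :
    ∃ n : ℕ, ((higherUnits ϖ n : Subgroup 𝒪[K]ˣ) : Set 𝒪[K]ˣ) ⊆ W := by
  obtain ⟨V, hV, hVW⟩ := isEmbedding_val.isInducing.isOpen_iff.mp hW
  have h1V : (1 : 𝒪[K]) ∈ V := by
    have : (1 : 𝒪[K]ˣ) ∈ Units.val ⁻¹' V := by rw [hVW]; exact h1
    simpa using this
  obtain ⟨ε, hε, hball⟩ := Metric.isOpen_iff.mp hV 1 h1V
  obtain ⟨n, hn⟩ := exists_pow_lt_of_lt_one hε (Valued.integer.norm_irreducible_lt_one hϖ)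
  refine ⟨n, ?_⟩
  rw [coe_higherUnits_eq hϖ n, ← hVW]
  intro u hu
  exact hball (Metric.closedBall_subset_ball hn hu)

/-- The basis hypothesis of `T5ProfiniteCharacterExtension.exists_continuous_extension_circle_of_basis`
holds for `𝒪[K]ˣ` with the explicit basis `U_n` (no compactness needed). -/
theorem basis_higherUnits [CompleteSpace K] (hϖ : Irreducible ϖ) :
    ∀ W : Set 𝒪[K]ˣ, IsOpen W → (1 : 𝒪[K]ˣ) ∈ W →
      ∃ U : Subgroup 𝒪[K]ˣ, IsOpen (U : Set 𝒪[K]ˣ) ∧ (U : Set 𝒪[K]ˣ) ⊆ W := by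
  intro W hW h1
  obtain ⟨n, hn⟩ := exists_higherUnits_subset hϖ hW h1
  exact ⟨higherUnits ϖ n, isOpen_higherUnits hϖ n, hn⟩

/-- **A continuous unitary character of `𝒪[K]ˣ` has finite conductor**: it is trivial on some
`U_n` (no small subgroups of the circle + the basis `U_n`). -/
theorem exists_higherUnits_le_ker [CompleteSpace K] (hϖ : Irreducible ϖ) (χ : 𝒪[K]ˣ →* Circle)
    (hχ : Continuous χ) : ∃ n : ℕ, higherUnits ϖ n ≤ χ.ker := by
  have hW : IsOpen {u : 𝒪[K]ˣ | 0 < ((χ u : Circle) : ℂ).re} :=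
    isOpen_lt continuous_const (Complex.continuous_re.comp (continuous_subtype_val.comp hχ))
  have h1 : (1 : 𝒪[K]ˣ) ∈ {u : 𝒪[K]ˣ | 0 < ((χ u : Circle) : ℂ).re} := by simp
  obtain ⟨n, hn⟩ := exists_higherUnits_subset hϖ hW h1
  refine ⟨n, fun u hu => ?_⟩
  rw [MonoidHom.mem_ker]
  apply eq_one_of_forall_pow_re_pos
  intro m
  have : u ^ m ∈ higherUnits ϖ n := (higherUnits ϖ n).pow_mem hu m
  have := hn this
  simpa [map_pow] using this

/-- **Continuity ⟺ finite conductor** for unitary characters of `𝒪[K]ˣ`. -/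
theorem continuous_iff_exists_higherUnits_le_ker [CompleteSpace K] (hϖ : Irreducible ϖ)
    (χ : 𝒪[K]ˣ →* Circle) : Continuous χ ↔ ∃ n : ℕ, higherUnits ϖ n ≤ χ.ker := by
  refine ⟨exists_higherUnits_le_ker hϖ χ, fun ⟨n, hn⟩ => ?_⟩
  exact continuous_of_eq_one_on_open_subgroup χ (higherUnits ϖ n) (isOpen_higherUnits hϖ n)
    fun u hu => MonoidHom.mem_ker.mp (hn hu)

/-- The same for `ℂˣ`-valued characters trivial on some `U_n`: they are continuous. -/
theorem continuous_of_higherUnits_le_ker (hϖ : Irreducible ϖ) (χ : 𝒪[K]ˣ →* ℂˣ) {n : ℕ}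
    (hn : higherUnits ϖ n ≤ χ.ker) : Continuous χ :=
  continuous_of_eq_one_on_open_subgroup χ (higherUnits ϖ n) (isOpen_higherUnits hϖ n)
    fun _ hu => MonoidHom.mem_ker.mp (hn hu)

end Summit.Ventures.HodgeRepro2.T5LocalUnitsFiltration
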